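import Summits.HodgeConjecture.CorCM.TwoSexticFieldsSeparation
import HarnessLib

/-!
# COR-CM — ANY two non-isomorphic sextic fields over one quadratic field: the ROTATIONS of the two `τ`-fibres are
# realised jointly by automorphisms of `ℂ` (no Galois/non-Galois hypothesis)

Cell `pub-hodgecm2` (COR-CM), seat b30 gen 16 (2026-08-21); COUNT-NEUTRAL; theorems only, no definition, no named fact,
no `sorry`.  Sequel of `CorCM/TwoSexticFieldsJointFrame.lean` (which realised all six permutations jointly but needed
both fields NON-Galois) and `CorCM/TwoSexticFieldsSeparation.lean` in the series TWO-FIELD-PAIR; it supplies the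
hypothesis `he_rot` of `CorCM/TwoSexticFieldsRotationTransfer.lean`.

SETTING.  `k` with `τ : k → ℂ`, `τ̄ ≠ τ`; two CM number fields `K₁ ⊇ i₁(k)`, `K₂ ⊇ i₂(k)` of degree `6` whose
embeddings restrict to `τ` or `τ̄`, enumerations `t_m : ℤ/3 → Hom(K_m, ℂ)` of the two `τ`-fibres.  The pairs of fibre
permutations realised by one automorphism of `ℂ` form `H ≤ S₃ × S₃`.

* §1 Kernel lemmas (`decide`): a transitive submonoid of `S₃` contains `A₃`; a submonoid of `S₃` normalised by the
  rotation `p ↦ p + 1` with a non-trivial element contains `A₃`; `(p ↦ p + j)³ = 1`.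
* §2 **`exists_ringEquiv_forall_comp_eq_rot₂`** — if the stabiliser of the fibre of `K₂` moves the fibre of `K₁` and
  vice versa (`hsep₁`, `hsep₂`; automatic from `Hom(K₁, K₂) = ∅`: `exists_fix_move_of_isEmpty`), then EVERY PAIR OF
  ROTATIONS `(p ↦ p + j₁, p ↦ p + j₂)` is realised jointly: both projections of `H` are transitive (`Aut(ℂ)` is transitive
  on `Hom(K_m, ℂ)`, the tree's `Pohlmann1968.isPretransitive_ringEquiv_complex`) hence contain `A₃`; the kernels are
  non-trivial and normalised by `A₃`, hence contain `A₃`; so `H ⊇ A₃ × A₃` [cite: Lang2002, I §12 Exercise 5, VI §1 Thm. 1.14]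
  [cite: Gordon1999HodgeAVSurvey, §9.2];
* §3 `exists_frame₀` — the frame `e : Hom(K, ℂ) ≃ ℤ/3 × Bool` adapted to an enumeration of the `τ`-fibre (`e (t p) =
  (p, true)`, `e ((t p)‾) = (p, false)`, conjugation flips the sign, sign `true` iff over `τ`) for ANY sextic `K`
  (gen 14's `NonGaloisField.exists_frame` minus the Galois clause) [cite: Shimura1998, §18.2];
  `exists_frame_place₀` — with a prescribed place for a type with one member over `τ`;
  `exists_joint_he_rot` — the frame form of §2 (the hypothesis `he_rot`).

## References
* [Lang2002] S. Lang, *Algebra*, 3rd ed., I §12 Ex. 5, VI §1 Thm. 1.14.  [Shimura1998] G. Shimura, *Abelian Varieties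
  with Complex Multiplication and Modular Functions* (1998), §18.2.  [Gordon1999HodgeAVSurvey] B. B. Gordon, §9.2.
-/

noncomputable section

namespace Summit.HodgeConjecture.CorCM.TwoSexticFields

open NumberField
open Literature.AlgebraicGeometry Literature.AlgebraicGeometry.Motives
open Literature.NumberTheory.ComplexMultiplication
open Summit.HodgeConjecture.CorCM.NonGaloisField

/-! ## §1 Kernel lemmas on `S₃` -/

section Kernel

set_option maxRecDepth 8000 in
set_option maxHeartbeats 4000000 in
set_option synthInstance.maxSize 4096 in
set_option synthInstance.maxHeartbeats 400000 in
/-- **A transitive submonoid of `S₃` contains `A₃`.** [folklore] -/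
theorem perm_transitive_subsets_cubes :
    ∀ P : Finset (Equiv.Perm (ZMod 3)), ((1 : Equiv.Perm (ZMod 3)) ∈ P ∧
      (∀ a ∈ P, ∀ b ∈ P, b * a ∈ P) ∧ (∀ x y : ZMod 3, ∃ g ∈ P, g x = y)) →
      ∀ c : Equiv.Perm (ZMod 3), c * c * c = 1 → c ∈ P := by
  decide +kernel

set_option maxRecDepth 8000 in
set_option maxHeartbeats 4000000 in
set_option synthInstance.maxSize 4096 in
set_option synthInstance.maxHeartbeats 400000 in
/-- **A submonoid of `S₃` normalised by the rotation `p ↦ p + 1` with a non-trivial element contains `A₃`.** [folklore] -/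
theorem perm_rotation_normal_subsets_cubes :
    ∀ N : Finset (Equiv.Perm (ZMod 3)), ((1 : Equiv.Perm (ZMod 3)) ∈ N ∧
      (∀ a ∈ N, ∀ b ∈ N, b * a ∈ N) ∧
      (∀ a ∈ N, Equiv.addRight (1 : ZMod 3) * a * (Equiv.addRight (1 : ZMod 3))⁻¹ ∈ N) ∧
      (∃ a ∈ N, a ≠ 1)) → ∀ c : Equiv.Perm (ZMod 3), c * c * c = 1 → c ∈ N := by
  decide +kernel

/-- Rotations are cube roots of `1`. [folklore] -/
theorem addRight_cube_eq_one : ∀ j : ZMod 3,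
    Equiv.addRight j * Equiv.addRight j * Equiv.addRight j = (1 : Equiv.Perm (ZMod 3)) := by
  decide

end Kernel

open scoped Classical

/-! ## §2 Joint realisation of the rotations -/

section Joint

variable {K₁ K₂ : Type} [Field K₁] [NumberField K₁] [IsCMField K₁] [Field K₂] [NumberField K₂] [IsCMField K₂]
  {k : Type} [Field k] {i₁ : k →+* K₁} {i₂ : k →+* K₂} {τ : k →+* ℂ}
  (hττ : ComplexEmbedding.conjugate τ ≠ τ)
  (hdich₁ : ∀ s : K₁ →+* ℂ, s.comp i₁ = τ ∨ s.comp i₁ = ComplexEmbedding.conjugate τ)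
  (hdich₂ : ∀ s : K₂ →+* ℂ, s.comp i₂ = τ ∨ s.comp i₂ = ComplexEmbedding.conjugate τ)
  {t₁ : ZMod 3 → (K₁ →+* ℂ)} (ht₁ : Function.Injective t₁) (hti₁ : ∀ p, (t₁ p).comp i₁ = τ)
  (htcov₁ : ∀ s : K₁ →+* ℂ, s.comp i₁ = τ → ∃ p, s = t₁ p)
  {t₂ : ZMod 3 → (K₂ →+* ℂ)} (ht₂ : Function.Injective t₂) (hti₂ : ∀ p, (t₂ p).comp i₂ = τ)
  (htcov₂ : ∀ s : K₂ →+* ℂ, s.comp i₂ = τ → ∃ p, s = t₂ p)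

omit [IsCMField K₁] [IsCMField K₂] in
include ht₁ hti₁ htcov₁ ht₂ hti₂ htcov₂ in
/-- **JOINT REALISATION OF THE ROTATIONS** (any two sextic fields over `(k, τ)` with separated fibres): every pair of
rotations `(p ↦ p + j₁, p ↦ p + j₂)` of the two `τ`-fibres is realised by ONE automorphism of `ℂ`.
[cite: Lang2002, I §12 Exercise 5 and VI §1 Thm. 1.14] [cite: Gordon1999HodgeAVSurvey, §9.2] -/
theorem exists_ringEquiv_forall_comp_eq_rot₂
    (hsep₁ : ∃ σ : ℂ ≃+* ℂ, (∀ p, (σ : ℂ →+* ℂ).comp (t₂ p) = t₂ p) ∧ ∃ p, (σ : ℂ →+* ℂ).comp (t₁ p) ≠ t₁ p)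
    (hsep₂ : ∃ σ : ℂ ≃+* ℂ, (∀ p, (σ : ℂ →+* ℂ).comp (t₁ p) = t₁ p) ∧ ∃ p, (σ : ℂ →+* ℂ).comp (t₂ p) ≠ t₂ p)
    (j₁ j₂ : ZMod 3) :
    ∃ σ : ℂ ≃+* ℂ, (∀ p, (σ : ℂ →+* ℂ).comp (t₁ p) = t₁ (p + j₁)) ∧ (∀ p, (σ : ℂ →+* ℂ).comp (t₂ p) = t₂ (p + j₂)) := by
  -- the relation of jointly realised pairs
  let J : Equiv.Perm (ZMod 3) → Equiv.Perm (ZMod 3) → Prop := fun π₁ π₂ =>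
    ∃ σ : ℂ ≃+* ℂ, (∀ p, (σ : ℂ →+* ℂ).comp (t₁ p) = t₁ (π₁ p)) ∧ (∀ p, (σ : ℂ →+* ℂ).comp (t₂ p) = t₂ (π₂ p))
  have h1 : J 1 1 := ⟨RingEquiv.refl ℂ, fun p => RingHom.ext fun _ => rfl, fun p => RingHom.ext fun _ => rfl⟩
  have hmul : ∀ a c a' c', J a c → J a' c' → J (a' * a) (c' * c) := by
    rintro a c a' c' ⟨σ, hσ₁, hσ₂⟩ ⟨σ', hσ'₁, hσ'₂⟩
    refine ⟨σ.trans σ', fun p => ?_, fun p => ?_⟩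
    · have hc : ((σ.trans σ' : ℂ ≃+* ℂ) : ℂ →+* ℂ).comp (t₁ p) = (σ' : ℂ →+* ℂ).comp ((σ : ℂ →+* ℂ).comp (t₁ p)) :=
        RingHom.ext fun _ => rfl
      rw [hc, hσ₁, hσ'₁, Equiv.Perm.mul_apply]
    · have hc : ((σ.trans σ' : ℂ ≃+* ℂ) : ℂ →+* ℂ).comp (t₂ p) = (σ' : ℂ →+* ℂ).comp ((σ : ℂ →+* ℂ).comp (t₂ p)) :=
        RingHom.ext fun _ => rfl
      rw [hc, hσ₂, hσ'₂, Equiv.Perm.mul_apply]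
  -- every automorphism fixing `τ` yields a realised pair
  have hpair : ∀ σ : ℂ ≃+* ℂ, (σ : ℂ →+* ℂ).comp τ = τ → ∃ a c, J a c ∧
      (∀ p, (σ : ℂ →+* ℂ).comp (t₁ p) = t₁ (a p)) ∧ (∀ p, (σ : ℂ →+* ℂ).comp (t₂ p) = t₂ (c p)) := by
    intro σ hσ
    obtain ⟨a, ha⟩ := exists_perm_of_comp_eq ht₁ hti₁ htcov₁ hσ
    obtain ⟨c, hc⟩ := exists_perm_of_comp_eq ht₂ hti₂ htcov₂ hσ
    exact ⟨a, c, ⟨σ, ha, hc⟩, ha, hc⟩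
  -- both projections are transitive (`Aut(ℂ)` is transitive on the embeddings)
  have htrans₁ : ∀ x y : ZMod 3, ∃ a c, J a c ∧ a x = y := by
    intro x y
    haveI := Literature.AlgebraicGeometry.Pohlmann1968.isPretransitive_ringEquiv_complex (K := K₁)
    obtain ⟨σ, hσ⟩ := MulAction.exists_smul_eq (ℂ ≃+* ℂ) (t₁ x) (t₁ y)
    have hσ' : (σ : ℂ →+* ℂ).comp (t₁ x) = t₁ y := hσ
    obtain ⟨a, c, hJ, ha, -⟩ := hpair σ (comp_eq_self_of_comp_t₁ hti₁ hσ')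
    exact ⟨a, c, hJ, ht₁ ((ha x).symm.trans hσ')⟩
  have htrans₂ : ∀ x y : ZMod 3, ∃ a c, J a c ∧ c x = y := by
    intro x y
    haveI := Literature.AlgebraicGeometry.Pohlmann1968.isPretransitive_ringEquiv_complex (K := K₂)
    obtain ⟨σ, hσ⟩ := MulAction.exists_smul_eq (ℂ ≃+* ℂ) (t₂ x) (t₂ y)
    have hσ' : (σ : ℂ →+* ℂ).comp (t₂ x) = t₂ y := hσ
    obtain ⟨a, c, hJ, -, hc⟩ := hpair σ (comp_eq_self_of_comp_t₁ hti₂ hσ')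
    exact ⟨a, c, hJ, ht₂ ((hc x).symm.trans hσ')⟩
  -- both kernels are non-trivial
  have hN₁ : ∃ a, a ≠ 1 ∧ J a 1 := by
    obtain ⟨σ, hfix, p₀, hmove⟩ := hsep₁
    obtain ⟨a, ha⟩ := exists_perm_of_comp_eq ht₁ hti₁ htcov₁ (comp_eq_self_of_comp_t₁ hti₂ (hfix 0))
    refine ⟨a, fun ha1 => hmove ?_, σ, ha, fun p => by rw [hfix p, Equiv.Perm.one_apply]⟩
    rw [ha p₀, ha1, Equiv.Perm.one_apply]
  have hN₂ : ∃ c, c ≠ 1 ∧ J 1 c := by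
    obtain ⟨σ, hfix, p₀, hmove⟩ := hsep₂
    obtain ⟨c, hc⟩ := exists_perm_of_comp_eq ht₂ hti₂ htcov₂ (comp_eq_self_of_comp_t₁ hti₁ (hfix 0))
    refine ⟨c, fun hc1 => hmove ?_, σ, fun p => by rw [hfix p, Equiv.Perm.one_apply], hc⟩
    rw [hc p₀, hc1, Equiv.Perm.one_apply]
  -- the projections contain `A₃`: in particular the rotation `r = (p ↦ p + 1)` with some partner
  have hr3 : Equiv.addRight (1 : ZMod 3) * Equiv.addRight (1 : ZMod 3) * Equiv.addRight (1 : ZMod 3) = 1 :=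
    addRight_cube_eq_one 1
  have hP₁ : ∃ c, J (Equiv.addRight (1 : ZMod 3)) c := by
    have h := perm_transitive_subsets_cubes (Finset.univ.filter fun a => ∃ c, J a c)
      ⟨by simp only [Finset.mem_filter, Finset.mem_univ, true_and]; exact ⟨1, h1⟩, fun a ha b hb => ?_,
        fun x y => ?_⟩ (Equiv.addRight (1 : ZMod 3)) hr3
    · simpa using h
    · simp only [Finset.mem_filter, Finset.mem_univ, true_and] at ha hb ⊢
      obtain ⟨c, hc⟩ := ha
      obtain ⟨c', hc'⟩ := hb
      exact ⟨c' * c, hmul _ _ _ _ hc hc'⟩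
    · obtain ⟨a, c, hJ, hxy⟩ := htrans₁ x y
      exact ⟨a, by simp only [Finset.mem_filter, Finset.mem_univ, true_and]; exact ⟨c, hJ⟩, hxy⟩
  have hP₂ : ∃ a, J a (Equiv.addRight (1 : ZMod 3)) := by
    have h := perm_transitive_subsets_cubes (Finset.univ.filter fun c => ∃ a, J a c)
      ⟨by simp only [Finset.mem_filter, Finset.mem_univ, true_and]; exact ⟨1, h1⟩, fun a ha b hb => ?_,
        fun x y => ?_⟩ (Equiv.addRight (1 : ZMod 3)) hr3
    · simpa using h
    · simp only [Finset.mem_filter, Finset.mem_univ, true_and] at ha hb ⊢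
      obtain ⟨c, hc⟩ := ha
      obtain ⟨c', hc'⟩ := hb
      exact ⟨c' * c, hmul _ _ _ _ hc hc'⟩
    · obtain ⟨a, c, hJ, hxy⟩ := htrans₂ x y
      exact ⟨c, by simp only [Finset.mem_filter, Finset.mem_univ, true_and]; exact ⟨a, hJ⟩, hxy⟩
  -- the kernels are normalised by `r`, hence contain `A₃`
  have hK₁ : ∀ x : Equiv.Perm (ZMod 3), x * x * x = 1 → J x 1 := by
    intro x hx
    obtain ⟨a₀, ha₀1, ha₀⟩ := hN₁
    obtain ⟨c, hc⟩ := hP₁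
    have h := perm_rotation_normal_subsets_cubes (Finset.univ.filter fun a => J a 1)
      ⟨by simpa using h1, fun a ha b hb => ?_, fun a ha => ?_, ⟨a₀, by simpa using ha₀, ha₀1⟩⟩ x hx
    · simpa using h
    · simp only [Finset.mem_filter, Finset.mem_univ, true_and] at ha hb ⊢
      simpa using hmul _ _ _ _ ha hb
    · simp only [Finset.mem_filter, Finset.mem_univ, true_and] at ha ⊢
      have h := hmul _ _ _ _ (hmul _ _ _ _ (goursat_inv h1 hmul hc) ha) hc
      rw [one_mul, mul_inv_cancel] at h
      rw [mul_assoc]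
      exact h
  have hK₂ : ∀ x : Equiv.Perm (ZMod 3), x * x * x = 1 → J 1 x := by
    intro x hx
    obtain ⟨c₀, hc₀1, hc₀⟩ := hN₂
    obtain ⟨a, ha⟩ := hP₂
    have h := perm_rotation_normal_subsets_cubes (Finset.univ.filter fun c => J 1 c)
      ⟨by simpa using h1, fun a ha b hb => ?_, fun c hc => ?_, ⟨c₀, by simpa using hc₀, hc₀1⟩⟩ x hx
    · simpa using h
    · simp only [Finset.mem_filter, Finset.mem_univ, true_and] at ha hb ⊢
      simpa using hmul _ _ _ _ ha hb
    · simp only [Finset.mem_filter, Finset.mem_univ, true_and] at hc ⊢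
      have h := hmul _ _ _ _ (hmul _ _ _ _ (goursat_inv h1 hmul ha) hc) ha
      rw [one_mul, mul_inv_cancel] at h
      rw [mul_assoc]
      exact h
  -- `(p ↦ p + j₁, p ↦ p + j₂) ∈ A₃ × A₃ ⊆ H`
  obtain ⟨σ, hσ₁, hσ₂⟩ : J (Equiv.addRight j₁) (Equiv.addRight j₂) := by
    have h := hmul _ _ _ _ (hK₁ _ (addRight_cube_eq_one j₁)) (hK₂ _ (addRight_cube_eq_one j₂))
    rw [one_mul, mul_one] at h
    exact h
  exact ⟨σ, fun p => by rw [hσ₁ p]; rfl, fun p => by rw [hσ₂ p]; rfl⟩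

end Joint

/-! ## §3 Frames for any sextic field, and the frame form `he_rot` -/

section Frame

variable {K : Type} [Field K] [NumberField K] [IsCMField K] {k : Type} [Field k] {i : k →+* K} {τ : k →+* ℂ}
  (hττ : ComplexEmbedding.conjugate τ ≠ τ)
  (hdich : ∀ s : K →+* ℂ, s.comp i = τ ∨ s.comp i = ComplexEmbedding.conjugate τ)

omit [IsCMField K] in
include hττ in
/-- **The frame adapted to an enumeration of the `τ`-fibre, any sextic `K`**: `e (t p) = (p, true)`,
`e ((t p)‾) = (p, false)`, every embedding is `t p` or `(t p)‾`, conjugation flips the sign, sign `true` iff over `τ`.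
[cite: Shimura1998, §18.2] -/
theorem exists_frame₀ {t : ZMod 3 → (K →+* ℂ)} (ht : Function.Injective t) (hti : ∀ p, (t p).comp i = τ)
    (h6 : Module.finrank ℚ K = 6) :
    ∃ e : (K →+* ℂ) ≃ ZMod 3 × Bool, (∀ p, e (t p) = (p, true)) ∧
      (∀ p, e (ComplexEmbedding.conjugate (t p)) = (p, false)) ∧
      (∀ s, ∃ p, s = t p ∨ s = ComplexEmbedding.conjugate (t p)) ∧
      (∀ s, e (ComplexEmbedding.conjugate s) = ((e s).1, !(e s).2)) ∧
      (∀ s, s.comp i = τ ↔ (e s).2 = true) := by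
  set g : ZMod 3 × Bool → (K →+* ℂ) := fun y => if y.2 then t y.1 else ComplexEmbedding.conjugate (t y.1) with hg
  have hgb : Function.Bijective g := bijective_frameInv hττ ht hti h6
  set e : (K →+* ℂ) ≃ ZMod 3 × Bool := (Equiv.ofBijective g hgb).symm with he
  have het : ∀ p, e (t p) = (p, true) := fun p => by
    rw [he, Equiv.symm_apply_eq, Equiv.ofBijective_apply, hg]
    simp
  have hec : ∀ p, e (ComplexEmbedding.conjugate (t p)) = (p, false) := fun p => by
    rw [he, Equiv.symm_apply_eq, Equiv.ofBijective_apply, hg]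
    simp
  have hcases : ∀ s : K →+* ℂ, ∃ p, s = t p ∨ s = ComplexEmbedding.conjugate (t p) := fun s => by
    obtain ⟨⟨p, b⟩, hb⟩ := hgb.2 s
    refine ⟨p, ?_⟩
    cases b
    · exact Or.inr hb.symm
    · exact Or.inl hb.symm
  refine ⟨e, het, hec, hcases, fun s => ?_, fun s => ?_⟩
  · obtain ⟨p, rfl | rfl⟩ := hcases s
    · rw [hec, het]; rfl
    · rw [ComplexEmbedding.involutive_conjugate K, het, hec]; rfl
  · obtain ⟨p, rfl | rfl⟩ := hcases s
    · rw [het]; exact ⟨fun _ => rfl, fun _ => hti p⟩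
    · rw [hec, conjugate_comp, hti]
      exact iff_of_false hττ (by simp)

omit [IsCMField K] in
include hττ hdich in
/-- **The frame with a prescribed place, any sextic `K`** (no Galois hypothesis): for a type `Φ` with exactly one
member over `τ` and `p₀ ∈ ℤ/3`, an enumeration `t` of the `τ`-fibre and a frame adapted to it reading `Φ` as «sign
`true` exactly over the place `p₀`». [cite: Shimura1998, §18.2] -/
theorem exists_frame_place₀ (h6 : Module.finrank ℚ K = 6) {Φ : CMType K}
    (hone : (Finset.univ.filter fun s : K →+* ℂ => s.comp i = τ ∧ s ∈ Φ.1).card = 1) (p₀ : ZMod 3) :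
    ∃ (t : ZMod 3 → (K →+* ℂ)) (e : (K →+* ℂ) ≃ ZMod 3 × Bool),
      Function.Injective t ∧ (∀ q, (t q).comp i = τ) ∧ (∀ s : K →+* ℂ, s.comp i = τ → ∃ q, s = t q) ∧
      (∀ q, e (t q) = (q, true)) ∧ (∀ q, e (ComplexEmbedding.conjugate (t q)) = (q, false)) ∧
      (∀ s, ∃ q, s = t q ∨ s = ComplexEmbedding.conjugate (t q)) ∧
      (∀ s, e (ComplexEmbedding.conjugate s) = ((e s).1, !(e s).2)) ∧
      (∀ s, s.comp i = τ ↔ (e s).2 = true) ∧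
      (∀ s, s ∈ Φ.1 ↔ (e s).2 = decide ((e s).1 = p₀)) := by
  -- the distinguished member `s₀ ∈ Φ` over `τ`
  obtain ⟨s₀, hs₀⟩ := Finset.card_eq_one.1 hone
  have hmem₀ : ∀ s, (s.comp i = τ ∧ s ∈ Φ.1) ↔ s = s₀ := fun s => by
    have := Finset.ext_iff.1 hs₀ s
    simpa using this
  have hs₀τ : s₀.comp i = τ := ((hmem₀ s₀).2 rfl).1
  have hs₀Φ : s₀ ∈ Φ.1 := ((hmem₀ s₀).2 rfl).2
  -- two further members of the fibre
  have h3 := DihedralSexticPair.card_fibre_eq_three hττ hdich h6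
  have h2 : ((Finset.univ.filter fun s : K →+* ℂ => s.comp i = τ).erase s₀).card = 2 := by
    rw [Finset.card_erase_of_mem (by simp [hs₀τ]), h3]
  obtain ⟨s₁, s₂, h12, hpair⟩ := Finset.card_eq_two.1 h2
  have hs₁ : s₁ ∈ (Finset.univ.filter fun s : K →+* ℂ => s.comp i = τ).erase s₀ := by rw [hpair]; simp
  have hs₂ : s₂ ∈ (Finset.univ.filter fun s : K →+* ℂ => s.comp i = τ).erase s₀ := by rw [hpair]; simp
  simp only [Finset.mem_erase, Finset.mem_filter, Finset.mem_univ, true_and] at hs₁ hs₂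
  -- the enumeration with `s₀` at the place `p₀`
  set t₀ : ZMod 3 → (K →+* ℂ) := ![s₀, s₁, s₂] with ht₀_def
  have ht₀i : ∀ q, (t₀ q).comp i = τ := by
    intro q; fin_cases q
    · exact hs₀τ
    · exact hs₁.2
    · exact hs₂.2
  have ht₀ : Function.Injective t₀ := by
    intro p q hpq
    fin_cases p <;> fin_cases q
    · rfl
    · exact absurd hpq (Ne.symm hs₁.1)
    · exact absurd hpq (Ne.symm hs₂.1)
    · exact absurd hpq hs₁.1
    · rfl
    · exact absurd hpq h12
    · exact absurd hpq hs₂.1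
    · exact absurd hpq (Ne.symm h12)
    · rfl
  set t : ZMod 3 → (K →+* ℂ) := fun q => t₀ (q - p₀) with ht_def
  have hti : ∀ q, (t q).comp i = τ := fun q => ht₀i _
  have ht : Function.Injective t := fun p q hpq => by simpa using ht₀ hpq
  have htp₀ : t p₀ = s₀ := by simp [ht_def, ht₀_def]
  have htcov : ∀ s : K →+* ℂ, s.comp i = τ → ∃ q, s = t q := by
    intro s hs
    have himg : (Finset.univ.filter fun s : K →+* ℂ => s.comp i = τ) = Finset.univ.image t := by
      symm
      apply Finset.eq_of_subset_of_card_le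
      · intro x hx
        obtain ⟨q, -, rfl⟩ := Finset.mem_image.1 hx
        simp [hti q]
      · rw [h3, Finset.card_image_of_injective _ ht]; simp
    have hs' : s ∈ Finset.univ.image t := by rw [← himg]; simp [hs]
    obtain ⟨q, -, hq⟩ := Finset.mem_image.1 hs'
    exact ⟨q, hq.symm⟩
  obtain ⟨e, het, hec, hcases, he_conj, he_sign⟩ := exists_frame₀ hττ ht hti h6
  refine ⟨t, e, ht, hti, htcov, het, hec, hcases, he_conj, he_sign, fun s => ?_⟩
  have hmemt : ∀ q, t q ∈ Φ.1 ↔ q = p₀ := fun q => by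
    constructor
    · intro h
      exact ht (((hmem₀ (t q)).1 ⟨hti q, h⟩).trans htp₀.symm)
    · rintro rfl
      rw [htp₀]; exact hs₀Φ
  obtain ⟨q, rfl | rfl⟩ := hcases s
  · rw [het, hmemt]
    simp
  · rw [hec, Φ.2, ComplexEmbedding.involutive_conjugate K, hmemt]
    simp

end Frame

section FrameForm

variable {K₁ K₂ : Type} [Field K₁] [NumberField K₁] [IsCMField K₁] [Field K₂] [NumberField K₂] [IsCMField K₂]
  {k : Type} [Field k] {i₁ : k →+* K₁} {i₂ : k →+* K₂} {τ : k →+* ℂ}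
  (hττ : ComplexEmbedding.conjugate τ ≠ τ)
  (hdich₁ : ∀ s : K₁ →+* ℂ, s.comp i₁ = τ ∨ s.comp i₁ = ComplexEmbedding.conjugate τ)
  (hdich₂ : ∀ s : K₂ →+* ℂ, s.comp i₂ = τ ∨ s.comp i₂ = ComplexEmbedding.conjugate τ)
  {t₁ : ZMod 3 → (K₁ →+* ℂ)} (ht₁ : Function.Injective t₁) (hti₁ : ∀ p, (t₁ p).comp i₁ = τ)
  (htcov₁ : ∀ s : K₁ →+* ℂ, s.comp i₁ = τ → ∃ p, s = t₁ p)
  {t₂ : ZMod 3 → (K₂ →+* ℂ)} (ht₂ : Function.Injective t₂) (hti₂ : ∀ p, (t₂ p).comp i₂ = τ)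
  (htcov₂ : ∀ s : K₂ →+* ℂ, s.comp i₂ = τ → ∃ p, s = t₂ p)

include ht₁ hti₁ htcov₁ ht₂ hti₂ htcov₂ in
/-- **The frame form `he_rot`**: in frames adapted to the enumerations, every pair of rotations `(p ↦ p + j₁, p ↦ p + j₂)`
is realised on `Hom(K₁, ℂ)` AND `Hom(K₂, ℂ)` by one automorphism of `ℂ` — for ANY two sextic CM fields over `(k, τ)`
with separated fibres. [cite: Lang2002, VI §1 Thm. 1.14] [cite: Shimura1998, §18.2 Lemma (i)] -/
theorem exists_joint_he_rot
    (hsep₁ : ∃ σ : ℂ ≃+* ℂ, (∀ p, (σ : ℂ →+* ℂ).comp (t₂ p) = t₂ p) ∧ ∃ p, (σ : ℂ →+* ℂ).comp (t₁ p) ≠ t₁ p)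
    (hsep₂ : ∃ σ : ℂ ≃+* ℂ, (∀ p, (σ : ℂ →+* ℂ).comp (t₁ p) = t₁ p) ∧ ∃ p, (σ : ℂ →+* ℂ).comp (t₂ p) ≠ t₂ p)
    {e₁ : (K₁ →+* ℂ) ≃ ZMod 3 × Bool} {e₂ : (K₂ →+* ℂ) ≃ ZMod 3 × Bool}
    (het₁ : ∀ p, e₁ (t₁ p) = (p, true)) (hec₁ : ∀ p, e₁ (ComplexEmbedding.conjugate (t₁ p)) = (p, false))
    (hcases₁ : ∀ s : K₁ →+* ℂ, ∃ p, s = t₁ p ∨ s = ComplexEmbedding.conjugate (t₁ p))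
    (het₂ : ∀ p, e₂ (t₂ p) = (p, true)) (hec₂ : ∀ p, e₂ (ComplexEmbedding.conjugate (t₂ p)) = (p, false))
    (hcases₂ : ∀ s : K₂ →+* ℂ, ∃ p, s = t₂ p ∨ s = ComplexEmbedding.conjugate (t₂ p))
    (j₁ j₂ : ZMod 3) :
    ∃ σ : ℂ ≃+* ℂ,
      (∀ s : K₁ →+* ℂ, e₁ ((σ : ℂ →+* ℂ).comp s) = ((e₁ s).1 + j₁, (e₁ s).2)) ∧
      (∀ s : K₂ →+* ℂ, e₂ ((σ : ℂ →+* ℂ).comp s) = ((e₂ s).1 + j₂, (e₂ s).2)) := by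
  obtain ⟨σ, hσ₁, hσ₂⟩ :=
    exists_ringEquiv_forall_comp_eq_rot₂ ht₁ hti₁ htcov₁ ht₂ hti₂ htcov₂ hsep₁ hsep₂ j₁ j₂
  refine ⟨σ, fun s => ?_, fun s => ?_⟩
  · obtain ⟨p, rfl | rfl⟩ := hcases₁ s
    · rw [hσ₁ p, het₁, het₁]
    · rw [comp_conjugate, hσ₁ p, hec₁, hec₁]
  · obtain ⟨p, rfl | rfl⟩ := hcases₂ s
    · rw [hσ₂ p, het₂, het₂]
    · rw [comp_conjugate, hσ₂ p, hec₂, hec₂]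

end FrameForm

end Summit.HodgeConjecture.CorCM.TwoSexticFields

end
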